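import Summits.AnomalousDissipation.AnomalousDissipation.Theorems.SawtoothPulseCascadeK1LocalisedCascadeSlotPairing

/-!
# K1loc, line `Spectral` / SeqCone — helper: TIME EVOLUTION OF THE LOCALISED SYMBOL ENERGY ON A SHEAR SLOT

Fourth S3b helper file of the prover lane on the crux `K1LocalisedCascade` (stmt-AnomalousDissipation-19491), route
`SawtoothPulseCascade` (architecture note `K1loc-architecture-findings-k1locp1.md`, F-b).  Setting: a classical
solution `θ` of `∂ₜθ + u·∇θ = κΔθ` on `[t₀,t₁] × 𝕋²` with the shear velocity `u(t) = ShearStage.drift i j φ (ρ t)`,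
the accumulated shear `Γ` (`Γ' = ρ`, smooth on `[t₀,t₁]`), the Lagrangian pull-back
`G = ShearStage.moved θ i j φ (−Γ)` (`…SlotPullback`: `∂ₜG = κ(Δθ)∘Φ_t`) and the localised field `F(t) = X(x_j)·G(t)`.
This file proves the time-dependent facts the slot lemma integrates:
* `isSmoothSpaceTimeOn_loc` — `F` is jointly smooth; `hasDerivWithinAt_mFourierCoeff_loc` — each Fourier coefficient
  `c_k(t) = 𝓕F(t)(k)` is differentiable within `[t₀,t₁]` with derivative `κ 𝓕(X(x_j)·(Δθ(t))∘Φ_t)(k)`;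
* `hasDerivWithinAt_symbolEnergy` — `d/dt ∑_{k∈S} w(k)‖c_k(t)‖² = 2κ Re ∑_{k∈S} w conj(c_k) 𝓕(X(x_j)·(Δθ)∘Φ_t)(k)`,
  which `…SlotPairing.re_sum_pairing_le` bounds;
* `scalarGradNormSq_eq_pullback` — `‖∇θ(t)‖² = ‖∂ᵢG(t)‖² + ‖D̄_tG(t)‖²` (change of variables), hence the
  ENERGY BUDGET `κ∫(‖∂ᵢG‖² + ‖D̄G‖²) dt = (‖θ(t₀)‖² − ‖θ(t₁)‖²)/2` from the tree's energy identity;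
* continuity in `t` of the `L²` norms entering the pairing bound (space integrals of jointly smooth fields).
WHAT THIS IS NOT: no statement about the cascade or the stub itself; no definitions.
[cite: BedrossianCotiZelati2017, §2 (advection–diffusion by a shear in shear coordinates; k-by-k energy estimates)]
[cite: DEIJ2022, (1.2)–(1.3) (the energy identity)] [problem: turb]
-/

-- `Summit.<Summit>.<Problem>`: single-conjunct summit, the duplicate namespace segment is deliberate.
set_option linter.dupNamespace false

noncomputable section

namespace Summit.AnomalousDissipation.AnomalousDissipation.Theorems.SawtoothPulseCascade.K1Slot

open MeasureTheory Set Filter Topology UnitAddTorus Function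
open scoped ContDiff InnerProductSpace
open Literature.Analysis Literature.Analysis.FunctionSpaces Literature.Analysis.FunctionSpaces.Torus
open Literature.Analysis.FluidPDE.ShearStage

-- BODY

section Evolution

open scoped ComplexConjugate

variable {i j : Fin 2}

/-! ## §1 Joint smoothness of the localised pull-back and of its building blocks -/

/-- A function of `t` alone, smooth on `S`, is a jointly smooth space–time field on `S`. [folklore] -/
theorem isSmoothSpaceTimeOn_of_time {S : Set ℝ} {Γ : ℝ → ℝ} (hΓ : ContDiffOn ℝ ∞ Γ S) :
    IsSmoothSpaceTimeOn S (fun t (_ : UnitAddTorus (Fin 2)) => Γ t) := by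
  unfold IsSmoothSpaceTimeOn
  have h : stLift (fun t (_ : UnitAddTorus (Fin 2)) => Γ t) = Γ ∘ Prod.fst := by funext p; rfl
  rw [h]
  exact hΓ.comp contDiffOn_fst fun p hp => (mem_prod.1 hp).1

/-- The localised pull-back `F(t,x) = X(x_j) · G(t,x)` is jointly smooth on `S`. [folklore] -/
theorem isSmoothSpaceTimeOn_loc {S : Set ℝ} (X : ShearProfile) {G : ℝ → UnitAddTorus (Fin 2) → ℝ}
    (hG : IsSmoothSpaceTimeOn S G) :
    IsSmoothSpaceTimeOn S (fun t x => X.onCircle (x j) * G t x) :=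
  (isSmoothSpaceTimeOn_const (isSmooth_onCircle_comp' X j) S).mul hG

/-- A complex character times the complexified localised field is jointly smooth. [folklore] -/
theorem isSmoothSpaceTimeOn_mFourier_smul {S : Set ℝ} {F : ℝ → UnitAddTorus (Fin 2) → ℝ}
    (hF : IsSmoothSpaceTimeOn S F) (k : Fin 2 → ℤ) :
    IsSmoothSpaceTimeOn S (fun t x => mFourier (-k) x * ((F t x : ℝ) : ℂ)) := by
  have h1 : IsSmoothSpaceTimeOn S (fun (_ : ℝ) (x : UnitAddTorus (Fin 2)) => (mFourier (-k) x : ℂ)) :=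
    isSmoothSpaceTimeOn_const (isSmooth_mFourier (d := Fin 2) (-k)) S
  have h2 : IsSmoothSpaceTimeOn S (fun t x => ((F t x : ℝ) : ℂ)) := hF.clm_comp Complex.ofRealCLM
  unfold IsSmoothSpaceTimeOn at h1 h2 ⊢
  exact h1.mul h2

/-! ## §2 Time derivative of the Fourier coefficients and of the symbol energy -/

/-- **Derivative of the Fourier coefficients of the localised pull-back.** With `G = moved θ i j φ (−Γ)` and
`F(t) = X(x_j)·G(t)`: `d/dt 𝓕F(t)(k) = κ · 𝓕(X(x_j)·(Δθ(t))∘Φ_t)(k)` within `S = [t₀,t₁]`.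
[cite: BedrossianCotiZelati2017, §2] -/
theorem hasDerivWithinAt_mFourierCoeff_loc (hij : i ≠ j) (P X : ShearProfile) {Γ ρ : ℝ → ℝ} {t₀ t₁ κ : ℝ}
    (ht : t₀ < t₁) {u : ℝ → UnitAddTorus (Fin 2) → EuclideanSpace ℝ (Fin 2)} {θ : ℝ → UnitAddTorus (Fin 2) → ℝ}
    (hθ : FluidPDE.Torus.IsClassicalScalarTransportOn (Icc t₀ t₁) κ u θ)
    (hu : ∀ t ∈ Icc t₀ t₁, u t = drift i j P (ρ t)) (hΓs : ContDiffOn ℝ ∞ Γ (Icc t₀ t₁))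
    {t : ℝ} (htm : t ∈ Icc t₀ t₁) (hΓρ : HasDerivWithinAt Γ (ρ t) (Icc t₀ t₁) t) (k : Fin 2 → ℤ) :
    HasDerivWithinAt
      (fun s => mFourierCoeff (fun x => ((X.onCircle (x j) * moved θ i j P (-Γ) s x : ℝ) : ℂ)) k)
      ((κ : ℂ) * mFourierCoeff (fun x => ((X.onCircle (x j) *
        laplacian (θ t) (moved (fun _ y => y) i j P (-Γ) t x) : ℝ) : ℂ)) k) (Icc t₀ t₁) t := by
  have hU : UniqueDiffOn ℝ (Icc t₀ t₁) := uniqueDiffOn_Icc ht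
  have hG : IsSmoothSpaceTimeOn (Icc t₀ t₁) (moved θ i j P (-Γ)) :=
    isSmoothSpaceTimeOn_moved_of_contDiffOn i j P hΓs hθ.smooth_scalar
  have hF : IsSmoothSpaceTimeOn (Icc t₀ t₁) (fun t x => X.onCircle (x j) * moved θ i j P (-Γ) t x) :=
    isSmoothSpaceTimeOn_loc X hG
  have hφ := isSmoothSpaceTimeOn_mFourier_smul hF k
  have hint := hφ.hasDerivWithinAt_integral (convex_Icc t₀ t₁) htm
  -- identify both sides
  have hlhs : (fun s => mFourierCoeff (fun x => ((X.onCircle (x j) * moved θ i j P (-Γ) s x : ℝ) : ℂ)) k) =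
      fun s => ∫ x, mFourier (-k) x * (((X.onCircle (x j) * moved θ i j P (-Γ) s x : ℝ)) : ℂ) := by
    funext s; rw [mFourierCoeff_eq_integral_volume]; simp only [smul_eq_mul]
  have hpt : ∀ x, timeDerivWithin (Icc t₀ t₁)
      (fun t x => mFourier (-k) x * (((X.onCircle (x j) * moved θ i j P (-Γ) t x : ℝ)) : ℂ)) t x =
      mFourier (-k) x * ((κ : ℂ) * (((X.onCircle (x j) *
        laplacian (θ t) (moved (fun _ y => y) i j P (-Γ) t x) : ℝ)) : ℂ)) := by
    intro x
    have h1 : HasDerivWithinAt (fun s => moved θ i j P (-Γ) s x)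
        (κ * laplacian (θ t) (moved (fun _ y => y) i j P (-Γ) t x)) (Icc t₀ t₁) t := by
      have := hG.hasDerivWithinAt_slice htm x
      rwa [timeDerivWithin_moved_eq_laplacian hU hij P hθ hu htm hΓρ x] at this
    have h2 : HasDerivWithinAt (fun s => (((X.onCircle (x j) * moved θ i j P (-Γ) s x : ℝ)) : ℂ))
        ((((X.onCircle (x j) * (κ * laplacian (θ t) (moved (fun _ y => y) i j P (-Γ) t x)) : ℝ)) : ℂ))
        (Icc t₀ t₁) t := by
      have := (h1.const_mul (X.onCircle (x j))).ofReal_comp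
      simpa using this
    have h3 := h2.const_mul (mFourier (-k) x : ℂ)
    rw [timeDerivWithin, (h3.derivWithin (hU t htm))]
    push_cast
    ring
  rw [hlhs]
  refine hint.congr_deriv ?_
  rw [mFourierCoeff_eq_integral_volume, ← integral_const_mul]
  refine integral_congr_ae (Eventually.of_forall fun x => ?_)
  simp only [hpt x, smul_eq_mul]
  ring

/-- **Derivative of the localised symbol energy.**  For a finite set of modes `S` and real weights `w`:
`d/dt ∑_{k∈S} w(k)‖𝓕F(t)(k)‖² = 2κ · Re ∑_{k∈S} w(k) conj(𝓕F(t)(k)) 𝓕(X(x_j)·(Δθ(t))∘Φ_t)(k)` within `[t₀,t₁]`.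
[cite: BedrossianCotiZelati2017, §2 (k-by-k energy identity)] -/
theorem hasDerivWithinAt_symbolEnergy (hij : i ≠ j) (P X : ShearProfile) {Γ ρ : ℝ → ℝ} {t₀ t₁ κ : ℝ}
    (ht : t₀ < t₁) {u : ℝ → UnitAddTorus (Fin 2) → EuclideanSpace ℝ (Fin 2)} {θ : ℝ → UnitAddTorus (Fin 2) → ℝ}
    (hθ : FluidPDE.Torus.IsClassicalScalarTransportOn (Icc t₀ t₁) κ u θ)
    (hu : ∀ t ∈ Icc t₀ t₁, u t = drift i j P (ρ t)) (hΓs : ContDiffOn ℝ ∞ Γ (Icc t₀ t₁))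
    {t : ℝ} (htm : t ∈ Icc t₀ t₁) (hΓρ : HasDerivWithinAt Γ (ρ t) (Icc t₀ t₁) t)
    (S : Finset (Fin 2 → ℤ)) (w : (Fin 2 → ℤ) → ℝ) :
    HasDerivWithinAt
      (fun s => ∑ k ∈ S, w k * ‖mFourierCoeff (fun x => ((X.onCircle (x j) * moved θ i j P (-Γ) s x : ℝ) : ℂ)) k‖ ^ 2)
      (2 * κ * (∑ k ∈ S, (w k : ℂ) *
        conj (mFourierCoeff (fun x => ((X.onCircle (x j) * moved θ i j P (-Γ) t x : ℝ) : ℂ)) k) *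
        mFourierCoeff (fun x => ((X.onCircle (x j) *
          laplacian (θ t) (moved (fun _ y => y) i j P (-Γ) t x) : ℝ) : ℂ)) k).re) (Icc t₀ t₁) t := by
  have hk := fun k => hasDerivWithinAt_mFourierCoeff_loc hij P X ht hθ hu hΓs htm hΓρ k
  have hsum := HasDerivWithinAt.fun_sum (u := S) fun k _ => ((hk k).norm_sq).const_mul (w k)
  refine hsum.congr_deriv ?_
  rw [Complex.re_sum, Finset.mul_sum]
  refine Finset.sum_congr rfl fun k _ => ?_
  rw [Complex.inner]
  simp only [Complex.mul_re, Complex.mul_im, Complex.conj_re, Complex.conj_im, Complex.ofReal_re,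
    Complex.ofReal_im]
  ring


/-! ## §3 The energy budget in pull-back form and continuity of the `L²` norms -/

/-- **The enstrophy in pull-back coordinates**: `‖∇θ(t)‖²_{L²} = ∫(∂ᵢG_t)² + ∫(D̄_tG_t)²`, `G_t = θ(t)∘Φ_t`,
`D̄_t = ∂ⱼ − Γ(t)Q(x_j)∂ᵢ` (`Q = φ'`), by the chain rule and the measure-preserving change of variables.
[cite: BedrossianCotiZelati2017, §2 (energy identities in shear coordinates)] -/
theorem scalarGradNormSq_eq_pullback (hij : i ≠ j) (P Q : ShearProfile) (hQ : ∀ y, Q y = deriv P y)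
    (Γ : ℝ → ℝ) {θ : ℝ → UnitAddTorus (Fin 2) → ℝ} {t : ℝ} (hθt : IsSmooth (θ t)) :
    FluidPDE.Torus.scalarGradNormSq (θ t) =
      (∫ x, partialDeriv i (moved θ i j P (-Γ) t) x ^ 2) +
        ∫ x, (partialDeriv j (moved θ i j P (-Γ) t) x -
          Γ t * Q.onCircle (x j) * partialDeriv i (moved θ i j P (-Γ) t) x) ^ 2 := by
  have hmv : moved θ i j P (-Γ) t = θ t ∘ shearMap i j (amp P (-Γ t)) := by
    funext x; rfl
  rw [FluidPDE.Torus.scalarGradNormSq_eq_sum_integral hθt, sum_univ_eq_add hij,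
    ← integral_comp_shearMap hij (amp P (-Γ t)) (fun x => partialDeriv i (θ t) x ^ 2),
    ← integral_comp_shearMap hij (amp P (-Γ t)) (fun x => partialDeriv j (θ t) x ^ 2), hmv]
  congr 1
  · refine integral_congr_ae (Eventually.of_forall fun x => ?_)
    simp only
    rw [partialDeriv_i_comp_shear hij hθt]
  · refine integral_congr_ae (Eventually.of_forall fun x => ?_)
    simp only
    rw [partialDeriv_j_comp_shear hθt, partialDeriv_i_comp_shear hij hθt, partialDeriv_onCircle_comp_eq P Q hQ]
    ring

/-- **The energy budget on the slot, pull-back form**: `κ∫_{t₀}^{t₁}(‖∂ᵢG_t‖² + ‖D̄_tG_t‖²) dt = (‖θ(t₀)‖² − ‖θ(t₁)‖²)/2`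
for a classical solution on `[t₀,t₁]` (the tree's energy identity `scalarL2Sq_add_scalarDissipation` rewritten with
`scalarGradNormSq_eq_pullback`). [cite: DEIJ2022, (1.2)–(1.3)] -/
theorem energy_budget_pullback (hij : i ≠ j) (P Q : ShearProfile) (hQ : ∀ y, Q y = deriv P y) (Γ : ℝ → ℝ)
    {t₀ t₁ κ : ℝ} (ht : t₀ ≤ t₁) {u : ℝ → UnitAddTorus (Fin 2) → EuclideanSpace ℝ (Fin 2)}
    {θ : ℝ → UnitAddTorus (Fin 2) → ℝ} (hθ : FluidPDE.Torus.IsClassicalScalarTransportOn (Icc t₀ t₁) κ u θ) :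
    κ * ∫ t in t₀..t₁, ((∫ x, partialDeriv i (moved θ i j P (-Γ) t) x ^ 2) +
        ∫ x, (partialDeriv j (moved θ i j P (-Γ) t) x -
          Γ t * Q.onCircle (x j) * partialDeriv i (moved θ i j P (-Γ) t) x) ^ 2) =
      (FluidPDE.Torus.scalarL2Sq (θ t₀) - FluidPDE.Torus.scalarL2Sq (θ t₁)) / 2 := by
  have hid := FluidPDE.Torus.IsClassicalScalarTransportOn.scalarL2Sq_add_scalarDissipation_holds hθ ht subset_rfl
  have hcongr : ∫ t in t₀..t₁, ((∫ x, partialDeriv i (moved θ i j P (-Γ) t) x ^ 2) +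
        ∫ x, (partialDeriv j (moved θ i j P (-Γ) t) x -
          Γ t * Q.onCircle (x j) * partialDeriv i (moved θ i j P (-Γ) t) x) ^ 2) =
      ∫ t in t₀..t₁, FluidPDE.Torus.scalarGradNormSq (θ t) := by
    refine intervalIntegral.integral_congr fun t htI => ?_
    rw [uIcc_of_le ht] at htI
    exact (scalarGradNormSq_eq_pullback hij P Q hQ Γ (hθ.smooth_scalar.isSmooth_slice htI)).symm
  rw [hcongr]
  simp only [FluidPDE.Torus.scalarDissipation] at hid
  linarith

/-- The scaled profile amplitude `−Γ(t)`: `moved θ i j φ (−Γ) t = θ(t) ∘ shearMap i j (amp φ (−Γ t))`. [folklore] -/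
theorem moved_neg_apply (θ : ℝ → UnitAddTorus (Fin 2) → ℝ) (P : ShearProfile) (Γ : ℝ → ℝ) (t : ℝ) :
    moved θ i j P (-Γ) t = θ t ∘ shearMap i j (amp P (-Γ t)) := by
  funext x; rfl

/-- Continuity in time of `∫ (a(t,x))²` for a jointly smooth field on a convex time set. [folklore] -/
theorem continuousOn_integral_sq {S : Set ℝ} (hS : Convex ℝ S) {a : ℝ → UnitAddTorus (Fin 2) → ℝ}
    (ha : IsSmoothSpaceTimeOn S a) : ContinuousOn (fun t => ∫ x, a t x ^ 2) S := by
  have h2 : IsSmoothSpaceTimeOn S (fun t x => a t x * a t x) := ha.mul ha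
  refine (h2.continuousOn_integral hS).congr fun t _ => ?_
  exact integral_congr_ae (Eventually.of_forall fun x => by simp [sq])

/-- Joint smoothness of the slot derivative `D̄_t G = ∂ⱼG − Γ(t)Q(x_j)∂ᵢG` of a jointly smooth `G`
(on a time set of unique differentiability, `Γ` smooth there). [folklore] -/
theorem isSmoothSpaceTimeOn_slotDeriv {S : Set ℝ} (hU : UniqueDiffOn ℝ S) (Q : ShearProfile) {Γ : ℝ → ℝ}
    (hΓ : ContDiffOn ℝ ∞ Γ S) {G : ℝ → UnitAddTorus (Fin 2) → ℝ} (hG : IsSmoothSpaceTimeOn S G) :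
    IsSmoothSpaceTimeOn S (fun t x => partialDeriv j (G t) x - Γ t * Q.onCircle (x j) * partialDeriv i (G t) x) := by
  have h1 : IsSmoothSpaceTimeOn S (fun t => partialDeriv j (G t)) := hG.partialDeriv hU j
  have h2 : IsSmoothSpaceTimeOn S (fun t => partialDeriv i (G t)) := hG.partialDeriv hU i
  have h3 : IsSmoothSpaceTimeOn S (fun t (x : UnitAddTorus (Fin 2)) => Γ t * Q.onCircle (x j)) :=
    (isSmoothSpaceTimeOn_of_time hΓ).mul (isSmoothSpaceTimeOn_const (isSmooth_onCircle_comp' Q j) S)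
  exact h1.sub (h3.mul h2)

/-- Joint smoothness of `Y(x_j) · ∂ᵢ G`. [folklore] -/
theorem isSmoothSpaceTimeOn_onCircle_mul_partialDeriv {S : Set ℝ} (hU : UniqueDiffOn ℝ S) (Y : ShearProfile)
    {G : ℝ → UnitAddTorus (Fin 2) → ℝ} (hG : IsSmoothSpaceTimeOn S G) (l : Fin 2) :
    IsSmoothSpaceTimeOn S (fun t x => Y.onCircle (x j) * partialDeriv l (G t) x) :=
  (isSmoothSpaceTimeOn_const (isSmooth_onCircle_comp' Y j) S).mul (hG.partialDeriv hU l)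

end Evolution

end Summit.AnomalousDissipation.AnomalousDissipation.Theorems.SawtoothPulseCascade.K1Slot
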